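import Summits.BirchSwinnertonDyer.Rank1Residual.X11b.AnticyclotomicEmbedding
import Literature.NumberTheory.EllipticCurves.FormalGroupPadicLogPointProofs
import Literature.NumberTheory.EllipticCurves.PadicPointsFiniteIndexProofs
import HarnessLib

/-!
# X11b, route R1 — `ord_p log_{ω_E} P` is well defined: independence of the multiple pushing the
# point into `E₁(ℚ_p)` (from the tree's PROVED additivity of the formal logarithm)

HONEST FRAMING (cell `b2b-bsdres`, run/shared/lean/b2b/bsd-rank1-residual/, verbatim in every
file): the goal of the cell is to DELETE the COMBINATION-SHAPED residual classes of the
Birch–Swinnerton-Dyer formula for ALL analytic-rank `≤ 1` elliptic curves over `ℚ` — "full BSD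
formula for every rank `≤ 1` curve in class `C`" assembled STRICTLY from published theorems — so
that the rank-`≤ 1` remainder becomes exactly the CONSTRUCTION-SHAPED classes, which are TYPED
(missing-input `Prop`s), NOT attempted. This is not "finishing BSD". Sub-cell
`b2b-bsdres-multr1-p1` (X11b, route R1); a RESEARCH ROUTE; no claim beyond the stated class; X11b
stays CONSTRUCTION-SHAPED; nothing here changes a label. THEOREMS ONLY (no definition, no named
fact, no `sorry`).

## Content

`AnticyclotomicEmbedding.lean` defines `padicLogOrd W p ι P := ord_p log_W(z(m₀ • P_ι)) − ord_p m₀`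
with the particular multiple `m₀ = [E(ℚ_p) : E₁(ℚ_p)]`. Castella's `log_{ω_E}` (Cas18 §2.2: "the
formal group logarithm defines an injective homomorphism `log_{ω_E} : E(K_𝔭)_{/tor} ⊗ ℤ_p → ℤ_p`
mapping `E_1(K_𝔭)` isomorphically onto `pℤ_p`") is the `ℤ_p`-LINEAR extension of the formal logarithm
from `E₁`; that `padicLogOrd` computes its valuation for ANY admissible multiple is the content of
this file, derived from the tree's PROVED additivity `WeierstrassCurve.padicLogPoint_add_holds`
(Silverman AEC IV.6.4(a), VII.2.2: `log_W z(P + Q) = log_W z(P) + log_W z(Q)` on `E₁(ℚ_p)` for a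
minimal equation):

* `padicLogPoint_nsmul` — for `Q ∈ E₁(ℚ_p)` (kernel of reduction) and `m : ℕ`: `m • Q ∈ E₁(ℚ_p)` and
  `log_W z(m • Q) = m · log_W z(Q)` (induction on `m`; `log_W z(O) = 0`).
* `padicLogPoint_nsmul_comm` — for any `Q ∈ E(ℚ_p)` and `m, m'` with `m • Q, m' • Q ∈ E₁(ℚ_p)`:
  `m' · log_W z(m • Q) = m · log_W z(m' • Q)` (both equal `log_W z(m m' • Q)`).
* **`padicLogOrd_eq_of_nsmul_mem`** — for `W/ℚ` globally minimal (so `W ⊗ ℚ_p` is `ℤ_p`-minimal),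
  an embedding `ι : K →+* ℚ_p`, `P ∈ E(K)`, and ANY `m ≠ 0` with `m • P_ι ∈ E₁(ℚ_p)` and
  `log_W z(m • P_ι) ≠ 0`: `padicLogOrd W p ι P = ord_p log_W(z(m • P_ι)) − ord_p m` — the definition
  does not depend on the choice `m₀`, i.e. it IS the valuation of Castella's `log_{ω_E}(P) ∈ ℚ_p`
  (`= log(mP)/m`). (For `P` of infinite order `log_W z(m • P_ι) ≠ 0`, AEC IV.6.4(b): `log` is
  injective on `Ê(pℤ_p)` for `p > 2`; not needed here, carried as a hypothesis.)

References: [Castella2018] §2.2 (arXiv:1704.06608 p. 5); [SilvermanAEC2009] IV.6.4, VII.2.2.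
-/

noncomputable section

open scoped Classical

open WeierstrassCurve NumberField IsDedekindDomain Literature.NumberTheory.EllipticCurves

namespace Summit.BirchSwinnertonDyer.Rank1Residual.X11b

section Local

variable {p : ℕ} [Fact p.Prime] (X : WeierstrassCurve ℚ_[p]) [X.IsMinimal ℤ_[p]]

/-- **`log_W z(m • Q) = m · log_W z(Q)` on `E₁(ℚ_p)`** (and `m • Q ∈ E₁(ℚ_p)`), for a `ℤ_p`-minimal
equation: induction on `m` from the tree's proved additivity `padicLogPoint_add_holds` (AEC VII.2.2 +
IV.6.4(a)) and `log_W z(O) = log_W(0) = 0`. [cite: SilvermanAEC2009, VII.2.2 and IV.6.4] -/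
theorem padicLogPoint_nsmul (Q : X.toAffine.Point) (hQ : X.IsInReductionKernel Q) (m : ℕ) :
    X.IsInReductionKernel (m • Q) ∧ X.padicLogPoint (m • Q) = (m : ℚ_[p]) * X.padicLogPoint Q := by
  induction m with
  | zero =>
    refine ⟨by rw [zero_nsmul]; exact X.isInReductionKernel_zero, ?_⟩
    rw [zero_nsmul, Nat.cast_zero, zero_mul, padicLogPoint, formalParameter_zero, padicFormalLog_zero]
  | succ m ih =>
    obtain ⟨hmem, hlog⟩ := ih
    obtain ⟨hmem', hlog'⟩ := padicLogPoint_add_holds p X (m • Q) Q hmem hQ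
    refine ⟨by rw [succ_nsmul]; exact hmem', ?_⟩
    rw [succ_nsmul, hlog', hlog, Nat.cast_succ]
    ring

/-- **`m' · log_W z(m • Q) = m · log_W z(m' • Q)`** whenever both multiples lie in `E₁(ℚ_p)` (both
sides are `log_W z(m m' • Q)`): the `ℤ_p`-linear extension `log Q := log(mQ)/m` of Castella's
`log_{ω_E}` to `E(K_𝔭)_{/tor} ⊗ ℤ_p` is well defined. [cite: Castella2018, §2.2 (arXiv:1704.06608 p. 5)]
[cite: SilvermanAEC2009, VII.2.2 and IV.6.4] -/
theorem padicLogPoint_nsmul_comm (Q : X.toAffine.Point) {m m' : ℕ}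
    (hm : X.IsInReductionKernel (m • Q)) (hm' : X.IsInReductionKernel (m' • Q)) :
    (m' : ℚ_[p]) * X.padicLogPoint (m • Q) = (m : ℚ_[p]) * X.padicLogPoint (m' • Q) := by
  have h1 := (padicLogPoint_nsmul X (m • Q) hm m').2
  have h2 := (padicLogPoint_nsmul X (m' • Q) hm' m).2
  rw [← h1, ← h2, ← mul_nsmul', mul_nsmul]

end Local

section Global

variable (W : WeierstrassCurve ℚ) [W.IsElliptic] [W.IsGloballyMinimal] (p : ℕ) [Fact p.Prime]
  {K : Type} [Field K] [NumberField K]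

/-- The global minimal model is `ℤ_p`-minimal over `ℚ_p` (tree `isMinimal_map_padic_of_isGloballyMinimal`),
as an instance for `W.baseChange ℚ_[p]`. [cite: SilvermanAEC2009, VIII.8 (global minimal equations)] -/
instance isMinimal_baseChange_padic : (W.baseChange ℚ_[p]).IsMinimal ℤ_[p] :=
  isMinimal_map_padic_of_isGloballyMinimal W p

/-- **`ord_p log_{ω_E} P` does not depend on the admissible multiple.** For ANY `m ≠ 0` with
`m • P_ι ∈ E₁(ℚ_p)` and `log_W z(m • P_ι) ≠ 0`:
`padicLogOrd W p ι P = ord_p log_W z(m • P_ι) − ord_p m` — so the definition (which uses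
`m₀ = [E(ℚ_p):E₁(ℚ_p)]`) is the valuation of Castella's `log_{ω_E}(P) = log(mP)/m`. Proof:
`m · log(m₀ P) = m₀ · log(m P)` (`padicLogPoint_nsmul_comm`), valuations are additive
(`Padic.valuation_mul`, `Padic.valuation_natCast`); `m₀ ≠ 0` and `log(m₀ P) ≠ 0` follow from the
right-hand side being non-zero. [cite: Castella2018, §2.2 and Thm. 2.3 (arXiv:1704.06608 p. 5)]
[cite: SilvermanAEC2009, IV.6.4 and VII.2.2] -/
theorem padicLogOrd_eq_of_nsmul_mem (ι : K →+* ℚ_[p]) (P : (W.baseChange K).toAffine.Point)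
    {m : ℕ} (hm0 : m ≠ 0)
    (hmem : (W.baseChange ℚ_[p]).IsInReductionKernel (m • padicPointOf W p ι P))
    (hne : (W.baseChange ℚ_[p]).padicLogPoint (m • padicPointOf W p ι P) ≠ 0) :
    padicLogOrd W p ι P =
      ((W.baseChange ℚ_[p]).padicLogPoint (m • padicPointOf W p ι P)).valuation -
        (padicValNat p m : ℤ) := by
  have hmem₀ : (W.baseChange ℚ_[p]).IsInReductionKernel (formalIndex W p • padicPointOf W p ι P) :=
    (formalIndex_smul_mem W p (padicPointOf W p ι P)).1
  -- `m · log(m₀ Q) = m₀ · log(m Q)`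
  have hcomm : (m : ℚ_[p]) *
        (W.baseChange ℚ_[p]).padicLogPoint (formalIndex W p • padicPointOf W p ι P) =
      (formalIndex W p : ℚ_[p]) * (W.baseChange ℚ_[p]).padicLogPoint (m • padicPointOf W p ι P) :=
    padicLogPoint_nsmul_comm (W.baseChange ℚ_[p]) (padicPointOf W p ι P) hmem₀ hmem
  have hmQ : (m : ℚ_[p]) ≠ 0 := by exact_mod_cast hm0
  -- `m₀ = [E(ℚ_p) : E₁(ℚ_p)] ≠ 0` (finite index, AEC VII.6.3; tree `finiteIndex_formalFiltration`)
  have hm₀0 : formalIndex W p ≠ 0 := by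
    haveI := (W.baseChange ℚ_[p]).finiteIndex_formalFiltration 1
    exact AddSubgroup.FiniteIndex.index_ne_zero
  have hm₀Q : (formalIndex W p : ℚ_[p]) ≠ 0 := by exact_mod_cast hm₀0
  have hlog₀ : (W.baseChange ℚ_[p]).padicLogPoint (formalIndex W p • padicPointOf W p ι P) ≠ 0 :=
    fun h ↦ by
    have h' : (formalIndex W p : ℚ_[p]) *
        (W.baseChange ℚ_[p]).padicLogPoint (m • padicPointOf W p ι P) = 0 := by
      rw [← hcomm, h, mul_zero]
    rcases mul_eq_zero.mp h' with h0 | h0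
    · exact hm₀Q h0
    · exact hne h0
  -- take valuations
  have hv := congrArg Padic.valuation hcomm
  rw [Padic.valuation_mul hmQ hlog₀, Padic.valuation_mul hm₀Q hne, Padic.valuation_natCast,
    Padic.valuation_natCast] at hv
  unfold padicLogOrd
  omega

end Global

end Summit.BirchSwinnertonDyer.Rank1Residual.X11b

end
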